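import Summits.Ventures.QEC.Census.RankCert
import HarnessLib

/-!
# CSS census rows in the kernel (CalibCSSN08): exact `[[n, k, d]]`, `d^X`, `d^Z` for the calibCSS cells n = 8

LADDER-QEC (venture cell `qec`), CENSUS-PREREG C.2 («all CSS codes from classical pairs `C₂^⊥ ⊆ C₁` … compared cell by
cell»; companion table census/search-5/css-n12/CSS-CALIB.tsv, qec-search-5: best CSS distance per cell `(n, k)`,
`n ≤ 12`, every instance certA ∧ certB ∧ ref-1 = tier COMPUTED in census/TABLE.tsv, family `calibCSS`, ids
`css_n<N>_k<K>`). This file is the KERNEL column of the LOWER half of those cells (existence with the exact parameters):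
for each row the CSS code (type-02 `CSSCode.ofMatrices`, Literature/…/CSS.lean) whose check matrices are the LITERAL gens
rows (`rowMatrix n <bitmasks>`, bit `j` = qubit `j` = character `j` of the gens string «leftmost = qubit 0») is proved
to be EXACTLY `[[n, k, d]]` (`CSSCode.IsCode`: `|Q| = n`, `k = n − rk H^X − rk H^Z`, `cssMinDist = d`) with its two
sector distances `d^X`, `d^Z`, by qec-type-10's distance-certificate checker `DistCert.checkDistCert`
(Census/CertCheck.lean: commutation, weight-`d` logical + non-membership witness, bruteforce replay of every word of
weight `< d` against the allow-list of low-weight stabilizers) and qec-type-02's rank certificates `RankCert.check`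
(Census/RankCert.lean), assembled by `DistCert.isCode_code`; every check is ONE `decide` (≤ 300-word replays) —
tier KERNEL-std, axioms ⊆ {propext, Classical.choice, Quot.sound}, no `native_decide`. The `k = 0` cells (CRSS
convention) and the UPPER half (no CSS `[[n, k, d+1]]`) are separate files. Certificates found and checked in-seat by
qec-type-02's `emit_css_calib.py` from the gens files alone (nothing from the producer is trusted: the kernel
recomputes every syndrome, weight, XOR and parity). HONEST FRAMING: these are statements about the 78 + 12 explicit
instances of the table, not about optimality; coverage of the cell grid is search-5's sentence (CSS-LP upper bounds,
COMPUTED), not claimed here. [folklore] throughout (elementary linear algebra over `𝔽₂`).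
-/

namespace Summit.Ventures.QEC.Census.CSS

open Summit.Ventures.QEC.Census Literature.InformationTheory.QuantumCodes

/-- Census row `css_n8_k1` (family `calibCSS`, CENSUS-PREREG C.2; gens census/search-5/css-n12/css_gens/css_n8_k1.txt, GENS-SHA matrix_sha256 `2b056568cc073bd8…`, file_sha16 `102c7905b1313e51`; certA `a3a896f15be76869` ∧ certB `cfedb218bb716aad`, ref-1 signed; search-5 provenance: ext([[7,1,3]] Steane (A=B=[7,3,4] simplex; Steane96))). The CSS code with the LITERAL check rows `H^X = [75, 45, 30]`, `H^Z = [128, 75, 45, 30]` (bitmasks, bit `j` = qubit `j` = character `j` of the gens string) is EXACTLY a `[[8, 1, 3]]` code (`d^X = 3`, `d^Z = 3`): distance certificate (type-10 `DistCert`, bruteforce replay of 72 words) + two rank certificates (type-02 `RankCert`, `r_X = 3`, `r_Z = 4`), all by `decide` — tier KERNEL-std. [folklore] -/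
theorem check_css_n8_k1 :
    ({ n := 8, HX := [75, 45, 30], HZ := [128, 75, 45, 30],
        sideZ := { d := 3, witness := 7, nonmember := 7, found := [(128, [0])] },
        sideX := { d := 3, witness := 7, nonmember := 7, found := [] } } : DistCert).checkDistCert = true := by
  decide

/-- Rank certificate of `H^X` of `css_n8_k1` accepted (`rank = 3`, `decide`). [folklore] -/
theorem rankX_css_n8_k1 : ({ r := 3, pivots := [0, 1, 2], rinv := [11, 10, 9], dependent := [] } : RankCert).check 8 [75, 45, 30] = true := by
  decide

/-- Rank certificate of `H^Z` of `css_n8_k1` accepted (`rank = 4`, `decide`). [folklore] -/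
theorem rankZ_css_n8_k1 : ({ r := 4, pivots := [0, 1, 2, 3], rinv := [128, 11, 10, 9], dependent := [] } : RankCert).check 8 [128, 75, 45, 30] = true := by
  decide

/-- **`css_n8_k1` is a `[[8, 1, 3]]` CSS code** (exact parameters, `CSSCode.IsCode`; KERNEL-std). [folklore] -/
theorem isCode_css_n8_k1 :
    (CSSCode.ofMatrices (rowMatrix 8 [75, 45, 30]) (rowMatrix 8 [128, 75, 45, 30])
      (comm_of_commOK (DistCert.commOK_of_check _ check_css_n8_k1))).IsCode 8 1 3 :=
  DistCert.isCode_code _ check_css_n8_k1 rankX_css_n8_k1 rankZ_css_n8_k1 (by decide)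

/-- `d^X = 3` for `css_n8_k1` (KERNEL-std). [folklore] -/
theorem dX_css_n8_k1 :
    (CSSCode.ofMatrices (rowMatrix 8 [75, 45, 30]) (rowMatrix 8 [128, 75, 45, 30])
      (comm_of_commOK (DistCert.commOK_of_check _ check_css_n8_k1))).dX = 3 :=
  DistCert.dX_code _ check_css_n8_k1

/-- `d^Z = 3` for `css_n8_k1` (KERNEL-std). [folklore] -/
theorem dZ_css_n8_k1 :
    (CSSCode.ofMatrices (rowMatrix 8 [75, 45, 30]) (rowMatrix 8 [128, 75, 45, 30])
      (comm_of_commOK (DistCert.commOK_of_check _ check_css_n8_k1))).dZ = 3 :=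
  DistCert.dZ_code _ check_css_n8_k1

/-- Census row `css_n8_k2` (family `calibCSS`, CENSUS-PREREG C.2; gens census/search-5/css-n12/css_gens/css_n8_k2.txt, GENS-SHA matrix_sha256 `1df34052c7db3324…`, file_sha16 `cb3f43825779fb66`; certA `33a8568538af752e` ∧ certB `3a8bebf01f8ef272`, ref-1 signed; search-5 provenance: sub0(sub0(sub0(sub0([[8,6,2]] A=B=<1^n>))))). The CSS code with the LITERAL check rows `H^X = [255]`, `H^Z = [132, 101, 20, 9, 3]` (bitmasks, bit `j` = qubit `j` = character `j` of the gens string) is EXACTLY a `[[8, 2, 2]]` code (`d^X = 2`, `d^Z = 2`): distance certificate (type-10 `DistCert`, bruteforce replay of 16 words) + two rank certificates (type-02 `RankCert`, `r_X = 1`, `r_Z = 5`), all by `decide` — tier KERNEL-std. [folklore] -/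
theorem check_css_n8_k2 :
    ({ n := 8, HX := [255], HZ := [132, 101, 20, 9, 3],
        sideZ := { d := 2, witness := 5, nonmember := 43, found := [] },
        sideX := { d := 2, witness := 96, nonmember := 33, found := [] } } : DistCert).checkDistCert = true := by
  decide

/-- Rank certificate of `H^X` of `css_n8_k2` accepted (`rank = 1`, `decide`). [folklore] -/
theorem rankX_css_n8_k2 : ({ r := 1, pivots := [0], rinv := [1], dependent := [] } : RankCert).check 8 [255] = true := by
  decide

/-- Rank certificate of `H^Z` of `css_n8_k2` accepted (`rank = 5`, `decide`). [folklore] -/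
theorem rankZ_css_n8_k2 : ({ r := 5, pivots := [0, 1, 2, 3, 4], rinv := [31, 11, 16, 8, 2], dependent := [] } : RankCert).check 8 [132, 101, 20, 9, 3] = true := by
  decide

/-- **`css_n8_k2` is a `[[8, 2, 2]]` CSS code** (exact parameters, `CSSCode.IsCode`; KERNEL-std). [folklore] -/
theorem isCode_css_n8_k2 :
    (CSSCode.ofMatrices (rowMatrix 8 [255]) (rowMatrix 8 [132, 101, 20, 9, 3])
      (comm_of_commOK (DistCert.commOK_of_check _ check_css_n8_k2))).IsCode 8 2 2 :=
  DistCert.isCode_code _ check_css_n8_k2 rankX_css_n8_k2 rankZ_css_n8_k2 (by decide)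

/-- `d^X = 2` for `css_n8_k2` (KERNEL-std). [folklore] -/
theorem dX_css_n8_k2 :
    (CSSCode.ofMatrices (rowMatrix 8 [255]) (rowMatrix 8 [132, 101, 20, 9, 3])
      (comm_of_commOK (DistCert.commOK_of_check _ check_css_n8_k2))).dX = 2 :=
  DistCert.dX_code _ check_css_n8_k2

/-- `d^Z = 2` for `css_n8_k2` (KERNEL-std). [folklore] -/
theorem dZ_css_n8_k2 :
    (CSSCode.ofMatrices (rowMatrix 8 [255]) (rowMatrix 8 [132, 101, 20, 9, 3])
      (comm_of_commOK (DistCert.commOK_of_check _ check_css_n8_k2))).dZ = 2 :=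
  DistCert.dZ_code _ check_css_n8_k2

/-- Census row `css_n8_k3` (family `calibCSS`, CENSUS-PREREG C.2; gens census/search-5/css-n12/css_gens/css_n8_k3.txt, GENS-SHA matrix_sha256 `2d8a2606a740b935…`, file_sha16 `dec352f0652f9451`; certA `54d6efa2e2fbe443` ∧ certB `1bc796b029e42028`, ref-1 signed; search-5 provenance: sub0(sub0(sub0([[8,6,2]] A=B=<1^n>)))). The CSS code with the LITERAL check rows `H^X = [255]`, `H^Z = [225, 20, 9, 3]` (bitmasks, bit `j` = qubit `j` = character `j` of the gens string) is EXACTLY a `[[8, 3, 2]]` code (`d^X = 2`, `d^Z = 2`): distance certificate (type-10 `DistCert`, bruteforce replay of 16 words) + two rank certificates (type-02 `RankCert`, `r_X = 1`, `r_Z = 4`), all by `decide` — tier KERNEL-std. [folklore] -/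
theorem check_css_n8_k3 :
    ({ n := 8, HX := [255], HZ := [225, 20, 9, 3],
        sideZ := { d := 2, witness := 5, nonmember := 20, found := [] },
        sideX := { d := 2, witness := 20, nonmember := 5, found := [] } } : DistCert).checkDistCert = true := by
  decide

/-- Rank certificate of `H^X` of `css_n8_k3` accepted (`rank = 1`, `decide`). [folklore] -/
theorem rankX_css_n8_k3 : ({ r := 1, pivots := [0], rinv := [1], dependent := [] } : RankCert).check 8 [255] = true := by
  decide

/-- Rank certificate of `H^Z` of `css_n8_k3` accepted (`rank = 4`, `decide`). [folklore] -/
theorem rankZ_css_n8_k3 : ({ r := 4, pivots := [0, 1, 2, 3], rinv := [11, 4, 8, 2], dependent := [] } : RankCert).check 8 [225, 20, 9, 3] = true := by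
  decide

/-- **`css_n8_k3` is a `[[8, 3, 2]]` CSS code** (exact parameters, `CSSCode.IsCode`; KERNEL-std). [folklore] -/
theorem isCode_css_n8_k3 :
    (CSSCode.ofMatrices (rowMatrix 8 [255]) (rowMatrix 8 [225, 20, 9, 3])
      (comm_of_commOK (DistCert.commOK_of_check _ check_css_n8_k3))).IsCode 8 3 2 :=
  DistCert.isCode_code _ check_css_n8_k3 rankX_css_n8_k3 rankZ_css_n8_k3 (by decide)

/-- `d^X = 2` for `css_n8_k3` (KERNEL-std). [folklore] -/
theorem dX_css_n8_k3 :
    (CSSCode.ofMatrices (rowMatrix 8 [255]) (rowMatrix 8 [225, 20, 9, 3])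
      (comm_of_commOK (DistCert.commOK_of_check _ check_css_n8_k3))).dX = 2 :=
  DistCert.dX_code _ check_css_n8_k3

/-- `d^Z = 2` for `css_n8_k3` (KERNEL-std). [folklore] -/
theorem dZ_css_n8_k3 :
    (CSSCode.ofMatrices (rowMatrix 8 [255]) (rowMatrix 8 [225, 20, 9, 3])
      (comm_of_commOK (DistCert.commOK_of_check _ check_css_n8_k3))).dZ = 2 :=
  DistCert.dZ_code _ check_css_n8_k3

/-- Census row `css_n8_k4` (family `calibCSS`, CENSUS-PREREG C.2; gens census/search-5/css-n12/css_gens/css_n8_k4.txt, GENS-SHA matrix_sha256 `f537fc7ccb89e59f…`, file_sha16 `d09a33271c5ed629`; certA `a7878dbd26700ab5` ∧ certB `9d5ffdac491d9ab6`, ref-1 signed; search-5 provenance: sub0(sub0([[8,6,2]] A=B=<1^n>))). The CSS code with the LITERAL check rows `H^X = [255]`, `H^Z = [245, 9, 3]` (bitmasks, bit `j` = qubit `j` = character `j` of the gens string) is EXACTLY a `[[8, 4, 2]]` code (`d^X = 2`, `d^Z = 2`): distance certificate (type-10 `DistCert`, bruteforce replay of 16 words) + two rank certificates (type-02 `RankCert`,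 `r_X = 1`, `r_Z = 3`), all by `decide` — tier KERNEL-std. [folklore] -/
theorem check_css_n8_k4 :
    ({ n := 8, HX := [255], HZ := [245, 9, 3],
        sideZ := { d := 2, witness := 5, nonmember := 20, found := [] },
        sideX := { d := 2, witness := 20, nonmember := 5, found := [] } } : DistCert).checkDistCert = true := by
  decide

/-- Rank certificate of `H^X` of `css_n8_k4` accepted (`rank = 1`, `decide`). [folklore] -/
theorem rankX_css_n8_k4 : ({ r := 1, pivots := [0], rinv := [1], dependent := [] } : RankCert).check 8 [255] = true := by
  decide

/-- Rank certificate of `H^Z` of `css_n8_k4` accepted (`rank = 3`, `decide`). [folklore] -/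
theorem rankZ_css_n8_k4 : ({ r := 3, pivots := [0, 1, 2], rinv := [4, 7, 2], dependent := [] } : RankCert).check 8 [245, 9, 3] = true := by
  decide

/-- **`css_n8_k4` is a `[[8, 4, 2]]` CSS code** (exact parameters, `CSSCode.IsCode`; KERNEL-std). [folklore] -/
theorem isCode_css_n8_k4 :
    (CSSCode.ofMatrices (rowMatrix 8 [255]) (rowMatrix 8 [245, 9, 3])
      (comm_of_commOK (DistCert.commOK_of_check _ check_css_n8_k4))).IsCode 8 4 2 :=
  DistCert.isCode_code _ check_css_n8_k4 rankX_css_n8_k4 rankZ_css_n8_k4 (by decide)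

/-- `d^X = 2` for `css_n8_k4` (KERNEL-std). [folklore] -/
theorem dX_css_n8_k4 :
    (CSSCode.ofMatrices (rowMatrix 8 [255]) (rowMatrix 8 [245, 9, 3])
      (comm_of_commOK (DistCert.commOK_of_check _ check_css_n8_k4))).dX = 2 :=
  DistCert.dX_code _ check_css_n8_k4

/-- `d^Z = 2` for `css_n8_k4` (KERNEL-std). [folklore] -/
theorem dZ_css_n8_k4 :
    (CSSCode.ofMatrices (rowMatrix 8 [255]) (rowMatrix 8 [245, 9, 3])
      (comm_of_commOK (DistCert.commOK_of_check _ check_css_n8_k4))).dZ = 2 :=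
  DistCert.dZ_code _ check_css_n8_k4

/-- Census row `css_n8_k5` (family `calibCSS`, CENSUS-PREREG C.2; gens census/search-5/css-n12/css_gens/css_n8_k5.txt, GENS-SHA matrix_sha256 `62efcc9df330e170…`, file_sha16 `1d295186218994d0`; certA `0ba2deb6c8d22721` ∧ certB `3fd5ce9f40080277`, ref-1 signed; search-5 provenance: sub0([[8,6,2]] A=B=<1^n>)). The CSS code with the LITERAL check rows `H^X = [255]`, `H^Z = [246, 9]` (bitmasks, bit `j` = qubit `j` = character `j` of the gens string) is EXACTLY a `[[8, 5, 2]]` code (`d^X = 2`, `d^Z = 2`): distance certificate (type-10 `DistCert`, bruteforce replay of 16 words) + two rank certificates (type-02 `RankCert`, `r_X = 1`, `r_Z = 2`), all by `decide` — tier KERNEL-std. [folklore] -/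
theorem check_css_n8_k5 :
    ({ n := 8, HX := [255], HZ := [246, 9],
        sideZ := { d := 2, witness := 3, nonmember := 9, found := [] },
        sideX := { d := 2, witness := 9, nonmember := 3, found := [] } } : DistCert).checkDistCert = true := by
  decide

/-- Rank certificate of `H^X` of `css_n8_k5` accepted (`rank = 1`, `decide`). [folklore] -/
theorem rankX_css_n8_k5 : ({ r := 1, pivots := [0], rinv := [1], dependent := [] } : RankCert).check 8 [255] = true := by
  decide

/-- Rank certificate of `H^Z` of `css_n8_k5` accepted (`rank = 2`, `decide`). [folklore] -/
theorem rankZ_css_n8_k5 : ({ r := 2, pivots := [0, 1], rinv := [2, 1], dependent := [] } : RankCert).check 8 [246, 9] = true := by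
  decide

/-- **`css_n8_k5` is a `[[8, 5, 2]]` CSS code** (exact parameters, `CSSCode.IsCode`; KERNEL-std). [folklore] -/
theorem isCode_css_n8_k5 :
    (CSSCode.ofMatrices (rowMatrix 8 [255]) (rowMatrix 8 [246, 9])
      (comm_of_commOK (DistCert.commOK_of_check _ check_css_n8_k5))).IsCode 8 5 2 :=
  DistCert.isCode_code _ check_css_n8_k5 rankX_css_n8_k5 rankZ_css_n8_k5 (by decide)

/-- `d^X = 2` for `css_n8_k5` (KERNEL-std). [folklore] -/
theorem dX_css_n8_k5 :
    (CSSCode.ofMatrices (rowMatrix 8 [255]) (rowMatrix 8 [246, 9])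
      (comm_of_commOK (DistCert.commOK_of_check _ check_css_n8_k5))).dX = 2 :=
  DistCert.dX_code _ check_css_n8_k5

/-- `d^Z = 2` for `css_n8_k5` (KERNEL-std). [folklore] -/
theorem dZ_css_n8_k5 :
    (CSSCode.ofMatrices (rowMatrix 8 [255]) (rowMatrix 8 [246, 9])
      (comm_of_commOK (DistCert.commOK_of_check _ check_css_n8_k5))).dZ = 2 :=
  DistCert.dZ_code _ check_css_n8_k5

/-- Census row `css_n8_k6` (family `calibCSS`, CENSUS-PREREG C.2; gens census/search-5/css-n12/css_gens/css_n8_k6.txt, GENS-SHA matrix_sha256 `4b4f5700cde0ca1e…`, file_sha16 `3f76e3b9077d5d93`; certA `d907cb5eb4a50a90` ∧ certB `b7afe4fab70cee22`, ref-1 signed; search-5 provenance: [[8,6,2]] A=B=<1^n>). The CSS code with the LITERAL check rows `H^X = [255]`, `H^Z = [255]` (bitmasks, bit `j` = qubit `j` = character `j` of the gens string) is EXACTLY a `[[8, 6, 2]]` code (`d^X = 2`, `d^Z = 2`): distance certificate (type-10 `DistCert`, bruteforce replay of 16 words) + two rank certificates (type-02 `RankCert`, `r_X = 1`, `r_Z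 = 1`), all by `decide` — tier KERNEL-std. [folklore] -/
theorem check_css_n8_k6 :
    ({ n := 8, HX := [255], HZ := [255],
        sideZ := { d := 2, witness := 3, nonmember := 5, found := [] },
        sideX := { d := 2, witness := 3, nonmember := 5, found := [] } } : DistCert).checkDistCert = true := by
  decide

/-- Rank certificate of `H^X` of `css_n8_k6` accepted (`rank = 1`, `decide`). [folklore] -/
theorem rankX_css_n8_k6 : ({ r := 1, pivots := [0], rinv := [1], dependent := [] } : RankCert).check 8 [255] = true := by
  decide

/-- Rank certificate of `H^Z` of `css_n8_k6` accepted (`rank = 1`, `decide`). [folklore] -/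
theorem rankZ_css_n8_k6 : ({ r := 1, pivots := [0], rinv := [1], dependent := [] } : RankCert).check 8 [255] = true := by
  decide

/-- **`css_n8_k6` is a `[[8, 6, 2]]` CSS code** (exact parameters, `CSSCode.IsCode`; KERNEL-std). [folklore] -/
theorem isCode_css_n8_k6 :
    (CSSCode.ofMatrices (rowMatrix 8 [255]) (rowMatrix 8 [255])
      (comm_of_commOK (DistCert.commOK_of_check _ check_css_n8_k6))).IsCode 8 6 2 :=
  DistCert.isCode_code _ check_css_n8_k6 rankX_css_n8_k6 rankZ_css_n8_k6 (by decide)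

/-- `d^X = 2` for `css_n8_k6` (KERNEL-std). [folklore] -/
theorem dX_css_n8_k6 :
    (CSSCode.ofMatrices (rowMatrix 8 [255]) (rowMatrix 8 [255])
      (comm_of_commOK (DistCert.commOK_of_check _ check_css_n8_k6))).dX = 2 :=
  DistCert.dX_code _ check_css_n8_k6

/-- `d^Z = 2` for `css_n8_k6` (KERNEL-std). [folklore] -/
theorem dZ_css_n8_k6 :
    (CSSCode.ofMatrices (rowMatrix 8 [255]) (rowMatrix 8 [255])
      (comm_of_commOK (DistCert.commOK_of_check _ check_css_n8_k6))).dZ = 2 :=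
  DistCert.dZ_code _ check_css_n8_k6

/-- Census row `css_n8_k7` (family `calibCSS`, CENSUS-PREREG C.2; gens census/search-5/css-n12/css_gens/css_n8_k7.txt, GENS-SHA matrix_sha256 `0b405a9270472f00…`, file_sha16 `4fcb7f808bfb985c`; certA `cadddf89068f06d8` ∧ certB `22d77560479977fd`, ref-1 signed; search-5 provenance: trivial CSS [[8,7,1]]). The CSS code with the LITERAL check rows `H^X = []`, `H^Z = [1]` (bitmasks, bit `j` = qubit `j` = character `j` of the gens string) is EXACTLY a `[[8, 7, 1]]` code (`d^X = 1`, `d^Z = 1`): distance certificate (type-10 `DistCert`, bruteforce replay of 0 words) + two rank certificates (type-02 `RankCert`, `r_X = 0`, `r_Z = 1`), all by `decide` — tier KERNEL-std. [folklore] -/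
theorem check_css_n8_k7 :
    ({ n := 8, HX := [], HZ := [1],
        sideZ := { d := 1, witness := 2, nonmember := 2, found := [] },
        sideX := { d := 1, witness := 2, nonmember := 2, found := [] } } : DistCert).checkDistCert = true := by
  decide

/-- Rank certificate of `H^X` of `css_n8_k7` accepted (`rank = 0`, `decide`). [folklore] -/
theorem rankX_css_n8_k7 : ({ r := 0, pivots := [], rinv := [], dependent := [] } : RankCert).check 8 [] = true := by
  decide

/-- Rank certificate of `H^Z` of `css_n8_k7` accepted (`rank = 1`, `decide`). [folklore] -/
theorem rankZ_css_n8_k7 : ({ r := 1, pivots := [0], rinv := [1], dependent := [] } : RankCert).check 8 [1] = true := by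
  decide

/-- **`css_n8_k7` is a `[[8, 7, 1]]` CSS code** (exact parameters, `CSSCode.IsCode`; KERNEL-std). [folklore] -/
theorem isCode_css_n8_k7 :
    (CSSCode.ofMatrices (rowMatrix 8 []) (rowMatrix 8 [1])
      (comm_of_commOK (DistCert.commOK_of_check _ check_css_n8_k7))).IsCode 8 7 1 :=
  DistCert.isCode_code _ check_css_n8_k7 rankX_css_n8_k7 rankZ_css_n8_k7 (by decide)

/-- `d^X = 1` for `css_n8_k7` (KERNEL-std). [folklore] -/
theorem dX_css_n8_k7 :
    (CSSCode.ofMatrices (rowMatrix 8 []) (rowMatrix 8 [1])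
      (comm_of_commOK (DistCert.commOK_of_check _ check_css_n8_k7))).dX = 1 :=
  DistCert.dX_code _ check_css_n8_k7

/-- `d^Z = 1` for `css_n8_k7` (KERNEL-std). [folklore] -/
theorem dZ_css_n8_k7 :
    (CSSCode.ofMatrices (rowMatrix 8 []) (rowMatrix 8 [1])
      (comm_of_commOK (DistCert.commOK_of_check _ check_css_n8_k7))).dZ = 1 :=
  DistCert.dZ_code _ check_css_n8_k7

/-- Census row `css_n8_k8` (family `calibCSS`, CENSUS-PREREG C.2; gens census/search-5/css-n12/css_gens/css_n8_k8.txt, GENS-SHA matrix_sha256 `1ab6bb51ceacb2a4…`, file_sha16 `0a3dc80011ce646b`; certA `b0fbf74907f7baa4` ∧ certB `0efd22fbc556cca0`, ref-1 signed; search-5 provenance: trivial CSS [[8,8,1]]). The CSS code with the LITERAL check rows `H^X = []`, `H^Z = []` (bitmasks, bit `j` = qubit `j` = character `j` of the gens string) is EXACTLY a `[[8, 8, 1]]` code (`d^X = 1`, `d^Z = 1`): distance certificate (type-10 `DistCert`, bruteforce replay of 0 words) + two rank certificates (type-02 `RankCert`, `r_X = 0`, `r_Z = 0`), all by `decide` —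 tier KERNEL-std. [folklore] -/
theorem check_css_n8_k8 :
    ({ n := 8, HX := [], HZ := [],
        sideZ := { d := 1, witness := 1, nonmember := 1, found := [] },
        sideX := { d := 1, witness := 1, nonmember := 1, found := [] } } : DistCert).checkDistCert = true := by
  decide

/-- Rank certificate of `H^X` of `css_n8_k8` accepted (`rank = 0`, `decide`). [folklore] -/
theorem rankX_css_n8_k8 : ({ r := 0, pivots := [], rinv := [], dependent := [] } : RankCert).check 8 [] = true := by
  decide

/-- Rank certificate of `H^Z` of `css_n8_k8` accepted (`rank = 0`, `decide`). [folklore] -/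
theorem rankZ_css_n8_k8 : ({ r := 0, pivots := [], rinv := [], dependent := [] } : RankCert).check 8 [] = true := by
  decide

/-- **`css_n8_k8` is a `[[8, 8, 1]]` CSS code** (exact parameters, `CSSCode.IsCode`; KERNEL-std). [folklore] -/
theorem isCode_css_n8_k8 :
    (CSSCode.ofMatrices (rowMatrix 8 []) (rowMatrix 8 [])
      (comm_of_commOK (DistCert.commOK_of_check _ check_css_n8_k8))).IsCode 8 8 1 :=
  DistCert.isCode_code _ check_css_n8_k8 rankX_css_n8_k8 rankZ_css_n8_k8 (by decide)

/-- `d^X = 1` for `css_n8_k8` (KERNEL-std). [folklore] -/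
theorem dX_css_n8_k8 :
    (CSSCode.ofMatrices (rowMatrix 8 []) (rowMatrix 8 [])
      (comm_of_commOK (DistCert.commOK_of_check _ check_css_n8_k8))).dX = 1 :=
  DistCert.dX_code _ check_css_n8_k8

/-- `d^Z = 1` for `css_n8_k8` (KERNEL-std). [folklore] -/
theorem dZ_css_n8_k8 :
    (CSSCode.ofMatrices (rowMatrix 8 []) (rowMatrix 8 [])
      (comm_of_commOK (DistCert.commOK_of_check _ check_css_n8_k8))).dZ = 1 :=
  DistCert.dZ_code _ check_css_n8_k8

end Summit.Ventures.QEC.Census.CSS
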